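import Mathlib
import Literature.MathematicalPhysics.StatisticalMechanics.Crystallization
import Literature.MathematicalPhysics.StatisticalMechanics.LennardJonesClusters

/-!
# Route `ReggeStarCoercivity`, crux stmt-AtomisticToContinuum-13601 `StabilityConstantTwelve`
# — line `Sketch`, stub `stub_reduction` (two-point minorant reduction)

Fisher–Ruelle / Cohn–Kumar zero-pressure reduction, finite form.  Let `g : ℝ → ℝ` be a function
of the *squared* distance which is positive definite in sum (the full double sum
`Σ_{i,j} g(|x_i - x_j|²)`, diagonal included, is `≥ 0` for every finite configuration in `ℝ³`),
with `g(r²) ≤ V_LJ(r)` for `r > 0` and `g(0) ≤ 2`.  Then for `N` distinct points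

  `2 𝓔_N(x) = Σ_i Σ_{k ≠ i} V_LJ(|x_i - x_k|) ≥ Σ_i Σ_{k ≠ i} g(|x_i - x_k|²)
            = Σ_{i,k} g(|x_i - x_k|²) - N g(0) ≥ 0 - 2N`,

i.e. `𝓔_N(x) ≥ -N`.  Uses `two_mul_interactionEnergy` / `siteEnergy`
(`LennardJonesClusters.lean`) and `interactionEnergy`, `lennardJones` (`Crystallization.lean`).
-/

noncomputable section

namespace Summit.AtomisticToContinuum.Crystallization.Theorems

open MeasureTheory Set Real
open scoped Nat
open Literature.MathematicalPhysics.StatisticalMechanics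

/-- STUB S1 (reduction). Fisher–Ruelle / Cohn–Kumar Prop. 9.3 at zero pressure, finite form:
a positive-definite-in-sum minorant `g` of `V_LJ` (as a function of the squared distance,
`g(r²) ≤ V_LJ(r)` for `r > 0`) with `g 0 ≤ 2` gives `𝓔_N(x) ≥ -N` for every configuration of
`N` distinct points: `2 𝓔_N(x) = Σ_i Σ_{k≠i} V_LJ ≥ Σ_{i,k} g - N g(0) ≥ -2N`. -/
theorem stub_reduction (g : ℝ → ℝ)
    (hpd : ∀ (N : ℕ) (x : Fin N → EuclideanSpace ℝ (Fin 3)), 0 ≤ ∑ i, ∑ j, g (‖x i - x j‖ ^ 2))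
    (hle : ∀ r : ℝ, 0 < r → g (r ^ 2) ≤ lennardJones r) (hg0 : g 0 ≤ 2)
    (N : ℕ) (x : Fin N → EuclideanSpace ℝ (Fin 3)) (hx : Function.Injective x) :
    -(N : ℝ) ≤ interactionEnergy lennardJones x := by
  -- off-diagonal pairs: distinct points are at positive distance, so the minorant applies
  have hoff : ∀ i k : Fin N, k ≠ i → g (‖x i - x k‖ ^ 2) ≤ lennardJones (dist (x i) (x k)) := by
    intro i k hki
    have hne : x i - x k ≠ 0 := sub_ne_zero.2 fun h => hki (hx h).symm
    rw [dist_eq_norm]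
    exact hle _ (norm_pos_iff.2 hne)
  -- per site: `Σ_k g(|x_i - x_k|²) - g 0 ≤ 𝓔ⁱ(x)`
  have hsite : ∀ i : Fin N,
      ∑ k, g (‖x i - x k‖ ^ 2) - g 0 ≤ siteEnergy lennardJones x i := by
    intro i
    unfold siteEnergy
    calc ∑ k, g (‖x i - x k‖ ^ 2) - g 0
          = ∑ k ∈ Finset.univ.erase i, g (‖x i - x k‖ ^ 2) := by
            rw [Finset.sum_erase_eq_sub (Finset.mem_univ i)]
            simp
      _ ≤ ∑ k ∈ Finset.univ.erase i, lennardJones (dist (x i) (x k)) :=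
            Finset.sum_le_sum fun k hk => hoff i k (Finset.ne_of_mem_erase hk)
  -- sum over sites and double counting
  have h2 : 2 * interactionEnergy lennardJones x = ∑ i, siteEnergy lennardJones x i :=
    two_mul_interactionEnergy lennardJones x
  have h3 : ∑ i, (∑ k, g (‖x i - x k‖ ^ 2) - g 0) ≤ ∑ i, siteEnergy lennardJones x i :=
    Finset.sum_le_sum fun i _ => hsite i
  rw [Finset.sum_sub_distrib, Finset.sum_const, Finset.card_univ, Fintype.card_fin,
    nsmul_eq_mul] at h3
  have h4 : 0 ≤ ∑ i, ∑ k, g (‖x i - x k‖ ^ 2) := hpd N x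
  have h5 : (N : ℝ) * g 0 ≤ (N : ℝ) * 2 := mul_le_mul_of_nonneg_left hg0 (Nat.cast_nonneg N)
  linarith

end Summit.AtomisticToContinuum.Crystallization.Theorems
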